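import Literature.NumberTheory.ComplexMultiplication.CyclotomicCMTypeClasses
import Literature.AlgebraicGeometry.Motives.MumfordTateRankOfCMType
import Literature.AlgebraicGeometry.Pohlmann1968.CMTypeRankCharactersNumberField
import HarnessLib

/-!
# Galois equivalence of CM types (Dina–Ionica–Sijsling 2022, Def. 8) versus Streng's equivalence: the two actions
# commute, and for an ABELIAN CM field they have the same classes

Layer `Literature/NumberTheory/ComplexMultiplication`, namespace `Literature.NumberTheory.ComplexMultiplication` (lane
`lit-hodgefound`, Track 2 foundations, Layer A3; seat `lit-hodgefound-p11`, generation 24, row g24-#5).  Sequel of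
`CMTypeEquivalenceClassesCount` (g24-#1/#2: `cmTypeEquivSetoid K`, Streng's `Φ′ = Φσ`, the counts) and
`CyclotomicCMTypeClasses` (g24-#4), on the tree's Galois translate `cmTypeSmul τ Φ = {τ ∘ φ : φ ∈ Φ}` (`τ ∈ Aut(ℂ)`;
`Motives/MumfordTateRankOfCMType`, Dodson's `Φᵍ`) and the Galois dictionary of
`Pohlmann1968/CMTypeRankCharactersNumberField` (`exists_algEquiv_comp_eq`, `exists_algEquiv_comp_eq_smul`,
`exists_ringEquiv_comp_eq_algEquiv`: for `K/ℚ` normal every embedding is `φ₀ ∘ g`, every `τ ∈ Aut(ℂ)` satisfies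
`τ ∘ φ₀ = φ₀ ∘ γ` for some `γ`, and every `γ` arises).  ONE honest definition with a body — the setoid
`cmTypeGaloisSetoid K` of Galois equivalence — everything else PROVED; no named fact, no instance (D-0026).

THE PRINT.  B. Dina, S. Ionica, J. Sijsling, *Isogenous hyperelliptic and non-hyperelliptic Jacobians with maximal
complex multiplication*, Math. Comp. 91 (2022) (held text arXiv:2104.04919, chunks p0006–p0008), §1.2:

> DEF. 8 «There is a natural left action of the Galois group `G = Gal(L/ℚ)` on CM types `Φ` of `K`. As subsets
> `Φ ⊂ G/H`, we have `σΦ = {σφ : φ ∈ Φ}` for `σ ∈ G`. … Note that these actions are well-defined because `ρ` is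
> central in `G`. We call the resulting equivalence on the set of CM types of `K` the Galois equivalence.»
> PROP. 10 «Let `K` be a sextic CM field with Galois group `C₆`. Then `K` admits `2` CM types up to equivalence,
> `1` of them primitive and `1` imprimitive. The same is true when replacing equivalence with Galois equivalence.»
> (proof: «two such CM types `S, S′` are equivalent if they are related by a translation … and the same is true for
> Galois equivalence»).
> REM. 14 «In genus `4`, it is no longer true that all primitive CM types are Galois equivalent. Let `K` be an octic
> CM field with Galois group `C₈` … the CM types `{0,1,2,3}` and `{0,1,2,6}` are primitive, yet they are not
> related even when combining the two equivalences.»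

DICTIONARY.  DIS's `G = Gal(L/ℚ)` (`L` the Galois closure) acting on `Hom(K, L) = G/H` is replaced by `Aut(ℂ)` acting on
`Hom(K, ℂ)` by composition (the tree's scoped `ringEquivCompAction` and `cmTypeSmul`): the two groups induce the same
permutations of the embeddings (tree `CMTypeDictionary.exists_ringEquiv_smul_eq_galAct` /
`exists_galAct_eq_ringEquiv_smul`), so the classes are the same.  Streng's equivalence `Φ′ = Φσ` (`σ ∈ Aut K`) is the
tree's `cmTypeEquivSetoid K` with the twist `Φσ = inducedCMType σ⁻¹ Φ`; «imprimitive» = induced from a strict CM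
subfield (`∃ k Ψ, k ≠ ⊤ ∧ inducedCMType (algebraMap k K) Ψ = Φ`), equivalently (g24-#3) not Shimura-primitive.

WHAT IS PROVED.
* §1 the translate: `mem_cmTypeSmul_iff`, action laws (`cmTypeSmul_one/_mul/_inv_cmTypeSmul`, `cmTypeSmul_injective`),
  **`cmTypeSmul_starRingAut` (`ιΦ = Φ̄`)**, **`cmTypeSmul_twist` (the left `Aut(ℂ)`- and right `Aut(K)`-actions
  commute: `τ(Φσ) = (τΦ)σ`)**, `cmTypeSmul_bar`.
* §2 **`cmTypeGaloisSetoid K`** (DIS Def. 8) with `_r_iff`, `cmTypeGaloisClass_eq_iff`; `Φ̄ ~_{Gal} Φ`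
  (`cmTypeGaloisSetoid_r_bar`); compatibility with twists both ways; finitely many, at most `2^g`, Galois classes.
* §3 `K/ℚ` normal with COMMUTATIVE `Gal(K/ℚ)`: **`cmTypeSmul_eq_twist_of_comp_eq`** (`τ ∘ φ₀ = φ₀ ∘ γ ⟹ τΦ = Φγ`),
  `exists_cmTypeSmul_eq_twist`, `exists_twist_eq_cmTypeSmul`, hence **`cmTypeGaloisSetoid_eq_cmTypeEquivSetoid`:
  for an ABELIAN CM field Galois equivalence IS Streng equivalence** (also `_of_isCyclic`), «combining the two
  equivalences» gives nothing new (`exists_cmTypeSmul_twist_eq_twist`), and the class counts agree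
  (`card_cmTypeGaloisClasses_eq`, `…_subtype_eq`).  §3b `|Aut K| = 2`: classes `{Φ, Φ̄}` lie inside Galois classes,
  `#{Galois classes} ≤ #{classes} = 2^{g−1}`.
* §4 instances: **DIS Prop. 10 in Galois form** — cyclic sextic: `2` Galois classes, `1` induced + `1` primitive, and
  ALL primitive types Galois equivalent (`cmTypeGaloisSetoid_r_of_isPrimitive_of_finrank_eq_six`, Cor. 13 for `C₆`);
  cyclic quartic: `1`; **DIS Rem. 14** — cyclic octic: `2` Galois classes and two primitive types NOT related «even when
  combining the two equivalences» (`exists_not_related_of_finrank_eq_eight`); degree `10`: `4`; degree `12`: `6`;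
  `ℚ(ζ_p)`: `cmTypeGaloisSetoid L = cmTypeEquivSetoid L`, `~_{Gal} ↔ IsAutTransform`, the divisor-sum count.

NOT HERE: the non-normal sextic counts of DIS Props. 11–12 up to Galois equivalence (`D₆`: `2`; `C₂³ ⋊ C₃`,
`C₂³ ⋊ S₃`: `1`), which need the Galois closure; Rem. 9 (conjugate abelian varieties carry `σΦ`) is the tree's
`AlgebraicGeometry/ComplexMultiplication/CMTypeGaloisConjugateIsogeny`; `𝔪𝔱(τΦ) = 𝔪𝔱(Φ)` is the tree's
`Motives.HodgeStructure.mumfordTateLieAlgebra_ofCMType_cmTypeSmul`.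

## References

* [DinaIonicaSijsling2022] B. Dina, S. Ionica, J. Sijsling, Math. Comp. 91 (2022) (arXiv:2104.04919), §1.2 Rem. 6,
  Prop. 7, Def. 8, Prop. 10, Props. 11–12, Cor. 13, Rem. 14.
* [Streng2010] M. Streng, *Complex multiplication of abelian surfaces*, thesis, Leiden (2010), Ch. I §3 (Def. 3.1,
  Lemma 3.4), pp. 20–21.
* [Shimura1998] G. Shimura, *Abelian Varieties with Complex Multiplication and Modular Functions* (1998), §8.1,
  §8.2 Prop. 26, §8.4 Example (1).
* [Dodson1987] B. Dodson, *On the Mumford–Tate group of an abelian variety with complex multiplication*, J. Algebra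
  111 (1987), §1.1 (p. 50).

## Provenance

Lane `lit-hodgefound` (HOME `run/shared/lean/pub/lit-hodgefound/`), prover seat `lit-hodgefound-p11` (gen 24),
self-proposed row g24-#5 (INBOX claim 2026-08-27, l.39807).
-/

set_option autoImplicit false

noncomputable section

open scoped Classical NumberField
open NumberField Module IntermediateField

namespace Literature.NumberTheory.ComplexMultiplication

open Literature.AlgebraicGeometry.Motives (CMType)
open Literature.AlgebraicGeometry.Motives.HodgeStructure (cmTypeSmul cmTypeSmul_val)
open Literature.AlgebraicGeometry (Pohlmann1968.exists_algEquiv_comp_eq Pohlmann1968.exists_algEquiv_comp_eq_smul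
  Pohlmann1968.exists_ringEquiv_comp_eq_algEquiv Pohlmann1968.conj_smul_eq_conjugate)
open scoped Pointwise

variable {K : Type} [Field K] [NumberField K] [IsCMField K]

/-! ## §1 Galois translates `τΦ = {τ ∘ φ : φ ∈ Φ}`: membership, the action laws, `conj Φ = Φ̄`, commuting with twists -/

section Translate

/-- `ψ ∈ τΦ ↔ τ⁻¹ψ ∈ Φ`. [cite: DinaIonicaSijsling2022, §1.2 Def. 8] [cite: Dodson1987, §1.1 (p. 50)] -/
theorem mem_cmTypeSmul_iff (τ : ℂ ≃+* ℂ) (Φ : CMType K) (ψ : K →+* ℂ) :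
    ψ ∈ (cmTypeSmul τ Φ).1 ↔ τ⁻¹ • ψ ∈ Φ.1 :=
  Set.mem_smul_set_iff_inv_smul_mem

/-- `τφ ∈ τΦ ↔ φ ∈ Φ`. [cite: DinaIonicaSijsling2022, §1.2 Def. 8] [cite: Dodson1987, §1.1 (p. 50)] -/
theorem smul_mem_cmTypeSmul_iff (τ : ℂ ≃+* ℂ) (Φ : CMType K) (φ : K →+* ℂ) :
    τ • φ ∈ (cmTypeSmul τ Φ).1 ↔ φ ∈ Φ.1 :=
  Set.smul_mem_smul_set_iff

/-- `1Φ = Φ`. [cite: DinaIonicaSijsling2022, §1.2 Def. 8] -/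
theorem cmTypeSmul_one (Φ : CMType K) : cmTypeSmul 1 Φ = Φ :=
  Subtype.ext (one_smul _ _)

/-- `(ττ′)Φ = τ(τ′Φ)` («a natural left action»). [cite: DinaIonicaSijsling2022, §1.2 Def. 8] -/
theorem cmTypeSmul_mul (τ τ' : ℂ ≃+* ℂ) (Φ : CMType K) :
    cmTypeSmul (τ * τ') Φ = cmTypeSmul τ (cmTypeSmul τ' Φ) :=
  Subtype.ext (mul_smul _ _ _)

/-- `τ⁻¹(τΦ) = Φ`. [cite: DinaIonicaSijsling2022, §1.2 Def. 8] -/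
theorem cmTypeSmul_inv_cmTypeSmul (τ : ℂ ≃+* ℂ) (Φ : CMType K) : cmTypeSmul τ⁻¹ (cmTypeSmul τ Φ) = Φ := by
  rw [← cmTypeSmul_mul, inv_mul_cancel, cmTypeSmul_one]

/-- `τ(τ⁻¹Φ) = Φ`. [cite: DinaIonicaSijsling2022, §1.2 Def. 8] -/
theorem cmTypeSmul_cmTypeSmul_inv (τ : ℂ ≃+* ℂ) (Φ : CMType K) : cmTypeSmul τ (cmTypeSmul τ⁻¹ Φ) = Φ := by
  rw [← cmTypeSmul_mul, mul_inv_cancel, cmTypeSmul_one]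

/-- `Φ ↦ τΦ` is injective. [cite: DinaIonicaSijsling2022, §1.2 Def. 8] -/
theorem cmTypeSmul_injective (τ : ℂ ≃+* ℂ) : Function.Injective (cmTypeSmul (K := K) τ) := fun Φ Ψ h => by
  rw [← cmTypeSmul_inv_cmTypeSmul τ Φ, h, cmTypeSmul_inv_cmTypeSmul]

/-- **Complex conjugation translates `Φ` to the conjugate type: `ιΦ = Φ̄`** (`ρ` «is central in `G`»).
[cite: DinaIonicaSijsling2022, §1.2 Def. 8] [cite: Streng2010, Ch. I §3 Def. 3.1, p. 20] -/
theorem cmTypeSmul_starRingAut (Φ : CMType K) : cmTypeSmul (starRingAut : ℂ ≃+* ℂ) Φ = CMTypeOps.bar Φ := by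
  refine Subtype.ext (Set.ext fun ψ => ?_)
  have hinv : (starRingAut : ℂ ≃+* ℂ)⁻¹ = starRingAut :=
    inv_eq_of_mul_eq_one_right (RingEquiv.ext fun z => by simp [RingAut.mul_apply])
  rw [mem_cmTypeSmul_iff, hinv, Pohlmann1968.conj_smul_eq_conjugate, CMTypeOps.conjugate_mem_iff_notMem,
    CMTypeOps.mem_bar_iff]

/-- **The left action of `Aut(ℂ)` and the right action of `Aut(K)` commute: `τ(Φσ) = (τΦ)σ`**
(`τ ∘ (φ ∘ σ) = (τ ∘ φ) ∘ σ`). [cite: DinaIonicaSijsling2022, §1.2 Rem. 6 and Def. 8] [cite: Streng2010, Ch. I §3, p. 20] -/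
theorem cmTypeSmul_twist (τ : ℂ ≃+* ℂ) (σ : K ≃ₐ[ℚ] K) (Φ : CMType K) :
    cmTypeSmul τ (inducedCMType (σ.symm : K →+* K) Φ) = inducedCMType (σ.symm : K →+* K) (cmTypeSmul τ Φ) :=
  Subtype.ext (Set.ext fun ψ => by
    rw [mem_cmTypeSmul_iff, mem_inducedCMType_iff, mem_inducedCMType_iff, mem_cmTypeSmul_iff]
    exact Iff.rfl)

/-- `τΦ̄` is the conjugate of `τΦ`. [cite: DinaIonicaSijsling2022, §1.2 Def. 8] [cite: Streng2010, Ch. I §3 Def. 3.1, p. 20] -/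
theorem cmTypeSmul_bar (τ : ℂ ≃+* ℂ) (Φ : CMType K) :
    cmTypeSmul τ (CMTypeOps.bar Φ) = CMTypeOps.bar (cmTypeSmul τ Φ) := by
  rw [CMTypeOps.bar_eq_twist_conjGal, cmTypeSmul_twist, ← CMTypeOps.bar_eq_twist_conjGal]

end Translate

/-! ## §2 The definition: Galois equivalence (DIS Def. 8) -/

section Defs

variable (K) in
/-- **Galois equivalence of CM types** (Dina–Ionica–Sijsling Def. 8): «There is a natural left action of the
Galois group `G = Gal(L/ℚ)` on CM types `Φ` of `K`. As subsets `Φ ⊂ G/H`, we have `σΦ = {σφ : φ ∈ Φ}` for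
`σ ∈ G` … We call the resulting equivalence on the set of CM types of `K` the Galois equivalence.»  Here the
embeddings are complex (`Hom(K, ℂ)`), and `G` is replaced by `Aut(ℂ)` acting by composition (the tree's
`cmTypeSmul`, Dodson's `Φᵍ`): the orbits are the same, since `Aut(ℂ)` and `Gal(K^c/ℚ)` induce the same
permutations of `Hom(K, ℂ)` (tree `CMTypeDictionary.exists_ringEquiv_smul_eq_galAct` /
`exists_galAct_eq_ringEquiv_smul`).  `Φ ~ Ψ` iff `Ψ = τΦ` for some `τ ∈ Aut(ℂ)`.
[cite: DinaIonicaSijsling2022, §1.2 Def. 8] [cite: Dodson1987, §1.1 (p. 50)] -/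
def cmTypeGaloisSetoid : Setoid (CMType K) where
  r Φ Ψ := ∃ τ : ℂ ≃+* ℂ, Ψ = cmTypeSmul τ Φ
  iseqv :=
    { refl := fun Φ => ⟨1, (cmTypeSmul_one Φ).symm⟩
      symm := fun {Φ Ψ} h => by
        obtain ⟨τ, rfl⟩ := h
        exact ⟨τ⁻¹, (cmTypeSmul_inv_cmTypeSmul τ Φ).symm⟩
      trans := fun {Φ Ψ Θ} h h' => by
        obtain ⟨τ, rfl⟩ := h
        obtain ⟨τ', rfl⟩ := h'
        exact ⟨τ' * τ, (cmTypeSmul_mul τ' τ Φ).symm⟩ }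

/-- Unfolding: `Φ ~_{Gal} Ψ ↔ ∃ τ, Ψ = τΦ`. [cite: DinaIonicaSijsling2022, §1.2 Def. 8] -/
theorem cmTypeGaloisSetoid_r_iff (Φ Ψ : CMType K) :
    (cmTypeGaloisSetoid K).r Φ Ψ ↔ ∃ τ : ℂ ≃+* ℂ, Ψ = cmTypeSmul τ Φ := Iff.rfl

/-- `⟦Φ⟧ = ⟦Ψ⟧ ↔ ∃ τ, Ψ = τΦ`. [cite: DinaIonicaSijsling2022, §1.2 Def. 8] -/
theorem cmTypeGaloisClass_eq_iff (Φ Ψ : CMType K) :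
    (Quotient.mk (cmTypeGaloisSetoid K) Φ) = Quotient.mk (cmTypeGaloisSetoid K) Ψ ↔
      ∃ τ : ℂ ≃+* ℂ, Ψ = cmTypeSmul τ Φ :=
  ⟨fun h => Quotient.exact h, fun h => Quotient.sound h⟩

/-- **`Φ̄` is Galois equivalent to `Φ`** (by complex conjugation `ι ∈ Aut(ℂ)`) — as it is Streng-equivalent to `Φ`
(`exists_eq_twist_bar`: `Φ̄ = Φc`). [cite: DinaIonicaSijsling2022, §1.2 Def. 8] [cite: Streng2010, Ch. I Lemma 3.4, pp. 20–21] -/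
theorem cmTypeGaloisSetoid_r_bar (Φ : CMType K) : (cmTypeGaloisSetoid K).r Φ (CMTypeOps.bar Φ) :=
  ⟨starRingAut, (cmTypeSmul_starRingAut Φ).symm⟩

/-- Galois equivalence is compatible with twisting: `Φ ~_{Gal} Ψ → Φσ ~_{Gal} Ψσ`.
[cite: DinaIonicaSijsling2022, §1.2 Def. 8 and Rem. 14] -/
theorem cmTypeGaloisSetoid_r_twist {Φ Ψ : CMType K} (h : (cmTypeGaloisSetoid K).r Φ Ψ) (σ : K ≃ₐ[ℚ] K) :
    (cmTypeGaloisSetoid K).r (inducedCMType (σ.symm : K →+* K) Φ) (inducedCMType (σ.symm : K →+* K) Ψ) := by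
  obtain ⟨τ, rfl⟩ := h
  exact ⟨τ, (cmTypeSmul_twist τ σ Φ).symm⟩

/-- Streng equivalence is compatible with Galois translation: `Φ ~ Ψ → τΦ ~ τΨ`.
[cite: DinaIonicaSijsling2022, §1.2 Def. 8 and Rem. 14] [cite: Streng2010, Ch. I §3, p. 20] -/
theorem cmTypeEquivSetoid_r_cmTypeSmul {Φ Ψ : CMType K} (h : (cmTypeEquivSetoid K).r Φ Ψ) (τ : ℂ ≃+* ℂ) :
    (cmTypeEquivSetoid K).r (cmTypeSmul τ Φ) (cmTypeSmul τ Ψ) := by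
  obtain ⟨σ, rfl⟩ := h
  exact ⟨σ, cmTypeSmul_twist τ σ Φ⟩

/-- There are finitely many Galois classes. [cite: DinaIonicaSijsling2022, §1.2 Def. 8] -/
theorem finite_cmTypeGaloisClasses : Finite (Quotient (cmTypeGaloisSetoid K)) := by
  haveI : Finite (CMType K) := finite_cmType
  exact Quotient.finite _

/-- At most `2^g` Galois classes. [cite: DinaIonicaSijsling2022, §1.2 Def. 8] -/
theorem card_cmTypeGaloisClasses_le : Nat.card (Quotient (cmTypeGaloisSetoid K)) ≤ 2 ^ (finrank ℚ K / 2) := by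
  haveI : Finite (CMType K) := finite_cmType
  rw [← CMTypeCount.natCard_cmType]
  exact Nat.card_le_card_of_surjective _ Quotient.mk_surjective

end Defs

/-! ## §3 `K/ℚ` Galois: `Aut(ℂ)` acts through `Gal(K/ℚ)`; ABELIAN `K`: Galois translates are twists and conversely -/

section Galois

/-- **The mechanism** (`K/ℚ` normal, `Gal(K/ℚ)` commutative): if `τ ∘ φ₀ = φ₀ ∘ γ` then `τΦ = Φγ` — every
embedding is `φ₀ ∘ g`, and `τ ∘ φ₀ ∘ g = φ₀ ∘ γ ∘ g = (φ₀ ∘ g) ∘ γ`.  (For `C₆`: «two such CM types `S, S′` are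
equivalent if they are related by a translation … and the same is true for Galois equivalence».)
[cite: DinaIonicaSijsling2022, §1.2 Prop. 10 (proof)] [cite: Shimura1998, §8.1] -/
theorem cmTypeSmul_eq_twist_of_comp_eq [Normal ℚ K] (hcomm : ∀ a b : K ≃ₐ[ℚ] K, a * b = b * a)
    {φ₀ : K →+* ℂ} {τ : ℂ ≃+* ℂ} {γ : K ≃ₐ[ℚ] K} (hγ : ∀ x, τ (φ₀ x) = φ₀ (γ x)) (Φ : CMType K) :
    cmTypeSmul τ Φ = inducedCMType (γ.symm : K →+* K) Φ := by
  refine Subtype.ext (Set.ext fun ψ => ?_)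
  obtain ⟨g, hg⟩ := Pohlmann1968.exists_algEquiv_comp_eq φ₀ ψ
  have key : τ⁻¹ • ψ = ψ.comp (γ.symm : K →+* K) := by
    refine RingHom.ext fun x => ?_
    rw [ringEquiv_smul_apply, RingHom.comp_apply]
    apply τ.injective
    change τ (τ.symm (ψ x)) = τ (ψ ((γ.symm : K →+* K) x))
    rw [τ.apply_symm_apply, ← hg x, RingHom.coe_coe, ← hg, hγ, ← AlgEquiv.mul_apply, hcomm, AlgEquiv.mul_apply,
      AlgEquiv.apply_symm_apply]
  rw [mem_cmTypeSmul_iff, mem_inducedCMType_iff, key]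

/-- **`K/ℚ` abelian: every Galois translate of a CM type is a twist** (`τΦ = Φγ` with `τ ∘ φ₀ = φ₀ ∘ γ`,
`Pohlmann1968.exists_algEquiv_comp_eq_smul`). [cite: DinaIonicaSijsling2022, §1.2 Prop. 10 (proof)] [cite: Shimura1998, §8.1] -/
theorem exists_cmTypeSmul_eq_twist [Normal ℚ K] (hcomm : ∀ a b : K ≃ₐ[ℚ] K, a * b = b * a) (τ : ℂ ≃+* ℂ)
    (Φ : CMType K) : ∃ γ : K ≃ₐ[ℚ] K, cmTypeSmul τ Φ = inducedCMType (γ.symm : K →+* K) Φ := by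
  obtain ⟨φ₀⟩ := (inferInstance : Nonempty (K →+* ℂ))
  obtain ⟨γ, hγ⟩ := Pohlmann1968.exists_algEquiv_comp_eq_smul φ₀ τ
  exact ⟨γ, cmTypeSmul_eq_twist_of_comp_eq hcomm hγ Φ⟩

/-- **`K/ℚ` abelian: every twist of a CM type is a Galois translate** (automorphisms of `φ₀(K)` extend to `ℂ`,
`Pohlmann1968.exists_ringEquiv_comp_eq_algEquiv`). [cite: DinaIonicaSijsling2022, §1.2 Prop. 10 (proof)] [cite: Shimura1998, §8.1] -/
theorem exists_twist_eq_cmTypeSmul [Normal ℚ K] (hcomm : ∀ a b : K ≃ₐ[ℚ] K, a * b = b * a) (γ : K ≃ₐ[ℚ] K)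
    (Φ : CMType K) : ∃ τ : ℂ ≃+* ℂ, inducedCMType (γ.symm : K →+* K) Φ = cmTypeSmul τ Φ := by
  obtain ⟨φ₀⟩ := (inferInstance : Nonempty (K →+* ℂ))
  obtain ⟨τ, hτ⟩ := Pohlmann1968.exists_ringEquiv_comp_eq_algEquiv φ₀ γ
  exact ⟨τ, (cmTypeSmul_eq_twist_of_comp_eq hcomm hτ Φ).symm⟩

/-- **`K/ℚ` ABELIAN ⟹ GALOIS EQUIVALENCE = EQUIVALENCE** (the two setoids coincide; DIS Prop. 10 for `C₆` «The same
is true when replacing equivalence with Galois equivalence», Rem. 14 for `C₈`). [cite: DinaIonicaSijsling2022, §1.2 Prop. 10 and Rem. 14] -/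
theorem cmTypeGaloisSetoid_eq_cmTypeEquivSetoid [Normal ℚ K] (hcomm : ∀ a b : K ≃ₐ[ℚ] K, a * b = b * a) :
    cmTypeGaloisSetoid K = cmTypeEquivSetoid K := by
  refine Setoid.ext fun Φ Ψ => ?_
  change (∃ τ : ℂ ≃+* ℂ, Ψ = cmTypeSmul τ Φ) ↔ ∃ σ : K ≃ₐ[ℚ] K, Ψ = inducedCMType (σ.symm : K →+* K) Φ
  constructor
  · rintro ⟨τ, rfl⟩
    exact exists_cmTypeSmul_eq_twist hcomm τ Φ
  · rintro ⟨σ, rfl⟩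
    obtain ⟨τ, hτ⟩ := exists_twist_eq_cmTypeSmul hcomm σ Φ
    exact ⟨τ, hτ⟩

/-- Cyclic Galois group ⟹ the same conclusion. [cite: DinaIonicaSijsling2022, §1.2 Prop. 10 and Rem. 14] -/
theorem cmTypeGaloisSetoid_eq_cmTypeEquivSetoid_of_isCyclic [Normal ℚ K] (hcyc : IsCyclic (K ≃ₐ[ℚ] K)) :
    cmTypeGaloisSetoid K = cmTypeEquivSetoid K :=
  cmTypeGaloisSetoid_eq_cmTypeEquivSetoid fun a b => by
    letI : CommGroup (K ≃ₐ[ℚ] K) := IsCyclic.commGroup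
    exact mul_comm a b

/-- `K/ℚ` abelian: «combining the two equivalences» gives nothing new — `τ(Φσ)` is again a twist of `Φ`.
[cite: DinaIonicaSijsling2022, §1.2 Rem. 14] -/
theorem exists_cmTypeSmul_twist_eq_twist [Normal ℚ K] (hcomm : ∀ a b : K ≃ₐ[ℚ] K, a * b = b * a) (τ : ℂ ≃+* ℂ)
    (σ : K ≃ₐ[ℚ] K) (Φ : CMType K) :
    ∃ γ : K ≃ₐ[ℚ] K, cmTypeSmul τ (inducedCMType (σ.symm : K →+* K) Φ) = inducedCMType (γ.symm : K →+* K) Φ := by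
  obtain ⟨γ, hγ⟩ := exists_cmTypeSmul_eq_twist hcomm τ (inducedCMType (σ.symm : K →+* K) Φ)
  exact ⟨σ * γ, by rw [hγ, twist_mul]⟩

/-- `K/ℚ` abelian: the numbers of Galois classes and of classes agree. [cite: DinaIonicaSijsling2022, §1.2 Prop. 10 and Rem. 14] -/
theorem card_cmTypeGaloisClasses_eq [Normal ℚ K] (hcomm : ∀ a b : K ≃ₐ[ℚ] K, a * b = b * a) :
    Nat.card (Quotient (cmTypeGaloisSetoid K)) = Nat.card (Quotient (cmTypeEquivSetoid K)) := by
  rw [cmTypeGaloisSetoid_eq_cmTypeEquivSetoid hcomm]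

/-- … also inside any family of types (e.g. the primitive ones, the induced ones).
[cite: DinaIonicaSijsling2022, §1.2 Prop. 10] -/
theorem card_cmTypeGaloisClasses_subtype_eq [Normal ℚ K] (hcomm : ∀ a b : K ≃ₐ[ℚ] K, a * b = b * a)
    (P : CMType K → Prop) :
    Nat.card {q : Quotient (cmTypeGaloisSetoid K) // ∀ Φ : CMType K, Quotient.mk _ Φ = q → P Φ} =
      Nat.card {q : Quotient (cmTypeEquivSetoid K) // ∀ Φ : CMType K, Quotient.mk _ Φ = q → P Φ} := by
  rw [cmTypeGaloisSetoid_eq_cmTypeEquivSetoid hcomm]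

end Galois

/-! ## §3b `|Aut(K)| = 2` (e.g. non-normal quartic / sextic CM fields, DIS Prop. 7 `N = ⟨H, ρ⟩`): classes `{Φ, Φ̄}` lie inside Galois classes -/

section AutTwo

/-- **`|Aut(K)| = 2` ⟹ Streng-equivalent types are Galois equivalent**: the classes are the pairs `{Φ, Φ̄}`
(`equiv_iff_eq_or_eq_bar_of_natCard_aut_eq_two`) and `Φ̄ = ιΦ`.  (DIS Prop. 7: for the non-normal sextic fields
`N_G(H)/H = ⟨ρ⟩`, so «up to equivalence» only identifies `Φ` with `Φ̄`, which Galois equivalence also does — whence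
`4 ↦ 2` classes in Prop. 11 and `4 ↦ 1` in Prop. 12.) [cite: DinaIonicaSijsling2022, §1.2 Prop. 7 and Props. 11–12] -/
theorem cmTypeGaloisSetoid_r_of_natCard_aut_eq_two (h2 : Nat.card (K ≃ₐ[ℚ] K) = 2) {Φ Ψ : CMType K}
    (h : (cmTypeEquivSetoid K).r Φ Ψ) : (cmTypeGaloisSetoid K).r Φ Ψ := by
  rcases (equiv_iff_eq_or_eq_bar_of_natCard_aut_eq_two h2 Φ Ψ).1 h with rfl | rfl
  · exact (cmTypeGaloisSetoid K).refl _
  · exact cmTypeGaloisSetoid_r_bar _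

/-- **`|Aut(K)| = 2` ⟹ there are at most as many Galois classes as classes** (`2^{g−1}` of the latter,
`card_classes_of_natCard_aut_eq_two`). [cite: DinaIonicaSijsling2022, §1.2 Prop. 7 and Props. 11–12] -/
theorem card_cmTypeGaloisClasses_le_of_natCard_aut_eq_two (h2 : Nat.card (K ≃ₐ[ℚ] K) = 2) :
    Nat.card (Quotient (cmTypeGaloisSetoid K)) ≤ Nat.card (Quotient (cmTypeEquivSetoid K)) := by
  haveI : Finite (CMType K) := finite_cmType
  refine Nat.card_le_card_of_surjective
    (Quotient.lift (fun Φ => Quotient.mk (cmTypeGaloisSetoid K) Φ)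
      (fun Φ Ψ h => Quotient.sound (cmTypeGaloisSetoid_r_of_natCard_aut_eq_two h2 h))) fun q => ?_
  obtain ⟨Φ, rfl⟩ := Quotient.exists_rep q
  exact ⟨Quotient.mk _ Φ, rfl⟩

/-- `|Aut(K)| = 2`: at most `2^{g−1}` Galois classes. [cite: DinaIonicaSijsling2022, §1.2 Prop. 7 and Props. 11–12] -/
theorem card_cmTypeGaloisClasses_le_two_pow_of_natCard_aut_eq_two (h2 : Nat.card (K ≃ₐ[ℚ] K) = 2) :
    Nat.card (Quotient (cmTypeGaloisSetoid K)) ≤ 2 ^ (finrank ℚ K / 2 - 1) := by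
  rw [← card_classes_of_natCard_aut_eq_two h2]
  exact card_cmTypeGaloisClasses_le_of_natCard_aut_eq_two h2

end AutTwo

/-! ## §4 Instances: cyclic sextic (DIS Prop. 10), cyclic quartic, cyclic octic (DIS Rem. 14), `ℚ(ζ_p)` -/

section Instances

omit [IsCMField K] in
/-- One class inside an invariant family ⟹ any two of its members are equivalent. [cite: DinaIonicaSijsling2022, §1.2 Prop. 7] -/
theorem cmTypeEquivSetoid_r_of_card_classes_subtype_eq_one (P : CMType K → Prop)
    (h1 : Nat.card {q : Quotient (cmTypeEquivSetoid K) // ∀ Φ : CMType K, Quotient.mk _ Φ = q → P Φ} = 1)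
    (hP : ∀ (σ : K ≃ₐ[ℚ] K) (Φ : CMType K), P Φ → P (inducedCMType (σ.symm : K →+* K) Φ))
    {Φ Ψ : CMType K} (hΦ : P Φ) (hΨ : P Ψ) : (cmTypeEquivSetoid K).r Φ Ψ := by
  haveI : Finite (CMType K) := finite_cmType
  have hmem : ∀ Θ : CMType K, P Θ → ∀ Θ' : CMType K, Quotient.mk (cmTypeEquivSetoid K) Θ' = Quotient.mk _ Θ → P Θ' := by
    intro Θ hΘ Θ' h
    obtain ⟨σ, rfl⟩ := (cmTypeClass_eq_iff Θ Θ').1 h.symm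
    exact hP σ Θ hΘ
  have hsub := (Nat.card_eq_one_iff_unique.1 h1).1
  have heq := Subsingleton.elim (α := {q : Quotient (cmTypeEquivSetoid K) // ∀ Φ : CMType K, Quotient.mk _ Φ = q → P Φ})
    ⟨Quotient.mk _ Φ, hmem Φ hΦ⟩ ⟨Quotient.mk _ Ψ, hmem Ψ hΨ⟩
  exact (cmTypeClass_eq_iff Φ Ψ).1 (congrArg Subtype.val heq)

/-! ### Cyclic sextic CM fields (`G = C₆`) — DIS Prop. 10 verbatim -/

/-- **DIS Prop. 10, Galois form: a cyclic sextic CM field has exactly `2` CM types up to Galois equivalence.**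
[cite: DinaIonicaSijsling2022, §1.2 Prop. 10] -/
theorem card_cmTypeGaloisClasses_eq_two_of_finrank_eq_six [IsGalois ℚ K] (h6 : finrank ℚ K = 6) :
    Nat.card (Quotient (cmTypeGaloisSetoid K)) = 2 := by
  rw [cmTypeGaloisSetoid_eq_cmTypeEquivSetoid_of_isCyclic (isCyclic_aut_of_finrank_eq_six h6)]
  exact card_classes_eq_two_of_finrank_eq_six h6

/-- **… `1` of them imprimitive** (the class of the two types induced from the imaginary quadratic subfield).
[cite: DinaIonicaSijsling2022, §1.2 Prop. 10] -/
theorem card_cmTypeGaloisClasses_induced_eq_one_of_finrank_eq_six [IsGalois ℚ K] (h6 : finrank ℚ K = 6) :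
    Nat.card {q : Quotient (cmTypeGaloisSetoid K) // ∀ Φ : CMType K, Quotient.mk _ Φ = q →
        ∃ (k : IntermediateField ℚ K) (Ψ : CMType k), k ≠ ⊤ ∧ inducedCMType (algebraMap k K) Ψ = Φ} = 1 := by
  rw [cmTypeGaloisSetoid_eq_cmTypeEquivSetoid_of_isCyclic (isCyclic_aut_of_finrank_eq_six h6)]
  exact card_classes_induced_eq_one_of_finrank_eq_six h6

/-- **… and `1` of them primitive.** [cite: DinaIonicaSijsling2022, §1.2 Prop. 10] -/
theorem card_cmTypeGaloisClasses_not_induced_eq_one_of_finrank_eq_six [IsGalois ℚ K] (h6 : finrank ℚ K = 6) :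
    Nat.card {q : Quotient (cmTypeGaloisSetoid K) // ∀ Φ : CMType K, Quotient.mk _ Φ = q →
        ¬ ∃ (k : IntermediateField ℚ K) (Ψ : CMType k), k ≠ ⊤ ∧ inducedCMType (algebraMap k K) Ψ = Φ} = 1 := by
  rw [cmTypeGaloisSetoid_eq_cmTypeEquivSetoid_of_isCyclic (isCyclic_aut_of_finrank_eq_six h6)]
  exact card_classes_not_induced_eq_one_of_finrank_eq_six h6

/-- **All primitive CM types of a cyclic sextic CM field are Galois equivalent** (DIS Cor. 13 in the case `C₆`;
here: primitive = not induced from a strict subfield). [cite: DinaIonicaSijsling2022, §1.2 Prop. 10 and Cor. 13] -/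
theorem cmTypeGaloisSetoid_r_of_not_induced_of_finrank_eq_six [IsGalois ℚ K] (h6 : finrank ℚ K = 6) {Φ Ψ : CMType K}
    (hΦ : ¬ ∃ (k : IntermediateField ℚ K) (Θ : CMType k), k ≠ ⊤ ∧ inducedCMType (algebraMap k K) Θ = Φ)
    (hΨ : ¬ ∃ (k : IntermediateField ℚ K) (Θ : CMType k), k ≠ ⊤ ∧ inducedCMType (algebraMap k K) Θ = Ψ) :
    (cmTypeGaloisSetoid K).r Φ Ψ := by
  rw [cmTypeGaloisSetoid_eq_cmTypeEquivSetoid_of_isCyclic (isCyclic_aut_of_finrank_eq_six h6)]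
  exact cmTypeEquivSetoid_r_of_card_classes_subtype_eq_one _ (card_classes_not_induced_eq_one_of_finrank_eq_six h6)
    (fun σ Θ h h' => h ((exists_inducedCMType_iff_twist Θ σ).1 h')) hΦ hΨ

/-- The same for Shimura-primitivity at any base embedding. [cite: DinaIonicaSijsling2022, §1.2 Prop. 10 and Cor. 13]
[cite: Shimura1998, §8.2 Prop. 26] -/
theorem cmTypeGaloisSetoid_r_of_isPrimitive_of_finrank_eq_six [IsGalois ℚ K] (h6 : finrank ℚ K = 6) {Φ Ψ : CMType K}
    (φ₀ : K →+* ℂ) (hΦ : IsPrimitive (ℂ ≃+* ℂ) Φ.1 φ₀) (hΨ : IsPrimitive (ℂ ≃+* ℂ) Ψ.1 φ₀) :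
    (cmTypeGaloisSetoid K).r Φ Ψ :=
  cmTypeGaloisSetoid_r_of_not_induced_of_finrank_eq_six h6
    ((SiegelCMPoint.not_exists_inducedCMType_iff_isPrimitive Φ φ₀).2 hΦ)
    ((SiegelCMPoint.not_exists_inducedCMType_iff_isPrimitive Ψ φ₀).2 hΨ)

/-! ### Cyclic quartic CM fields -/

/-- **Cyclic quartic CM field: all four CM types are Galois equivalent — ONE Galois class.**
[cite: Streng2010, Ch. I Lemma 3.4 (2), p. 21] [cite: DinaIonicaSijsling2022, §1.2 Def. 8] -/
theorem card_cmTypeGaloisClasses_eq_one_of_finrank_eq_four [IsGalois ℚ K] (hcyc : IsCyclic (K ≃ₐ[ℚ] K))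
    (h4 : finrank ℚ K = 4) : Nat.card (Quotient (cmTypeGaloisSetoid K)) = 1 := by
  rw [cmTypeGaloisSetoid_eq_cmTypeEquivSetoid_of_isCyclic hcyc]
  exact card_classes_eq_one_of_isCyclic_of_finrank_eq_four hcyc h4

/-! ### Cyclic octic CM fields (`G = C₈`, e.g. `ℚ(ζ₃₂ + ζ₃₂¹⁵)`) — DIS Rem. 14 -/

/-- **Cyclic octic CM field: exactly `2` Galois classes** (all `16` types primitive, `8` per class).
[cite: DinaIonicaSijsling2022, §1.2 Rem. 14] -/
theorem card_cmTypeGaloisClasses_eq_two_of_finrank_eq_eight [IsGalois ℚ K] (hcyc : IsCyclic (K ≃ₐ[ℚ] K))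
    (h8 : finrank ℚ K = 8) : Nat.card (Quotient (cmTypeGaloisSetoid K)) = 2 := by
  rw [cmTypeGaloisSetoid_eq_cmTypeEquivSetoid_of_isCyclic hcyc]
  exact card_classes_eq_two_of_isCyclic_of_finrank_eq_eight hcyc h8

/-- **DIS Rem. 14 «In genus `4`, it is no longer true that all primitive CM types are Galois equivalent … the CM
types `{0,1,2,3}` and `{0,1,2,6}` are primitive, yet they are not related even when combining the two
equivalences»**: a cyclic octic CM field has two (necessarily primitive) CM types `Φ`, `Ψ` with `Ψ ≠ τ(Φσ)` for all
`τ ∈ Aut(ℂ)`, `σ ∈ Aut(K)`. [cite: DinaIonicaSijsling2022, §1.2 Rem. 14] -/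
theorem exists_not_related_of_finrank_eq_eight [IsGalois ℚ K] (hcyc : IsCyclic (K ≃ₐ[ℚ] K)) (h8 : finrank ℚ K = 8)
    (φ₀ : K →+* ℂ) :
    ∃ Φ Ψ : CMType K, IsPrimitive (ℂ ≃+* ℂ) Φ.1 φ₀ ∧ IsPrimitive (ℂ ≃+* ℂ) Ψ.1 φ₀ ∧
      ∀ (τ : ℂ ≃+* ℂ) (σ : K ≃ₐ[ℚ] K), Ψ ≠ cmTypeSmul τ (inducedCMType (σ.symm : K →+* K) Φ) := by
  haveI : Finite (CMType K) := finite_cmType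
  have hcomm : ∀ a b : K ≃ₐ[ℚ] K, a * b = b * a := fun a b => by
    letI : CommGroup (K ≃ₐ[ℚ] K) := IsCyclic.commGroup
    exact mul_comm a b
  have h2 := card_classes_eq_two_of_isCyclic_of_finrank_eq_eight hcyc h8
  haveI : Finite (Quotient (cmTypeEquivSetoid K)) := Quotient.finite _
  haveI : Nontrivial (Quotient (cmTypeEquivSetoid K)) := Finite.one_lt_card_iff_nontrivial.1 (by rw [h2]; norm_num)
  obtain ⟨q, q', hqq'⟩ := exists_pair_ne (Quotient (cmTypeEquivSetoid K))
  obtain ⟨Φ, rfl⟩ := Quotient.exists_rep q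
  obtain ⟨Ψ, rfl⟩ := Quotient.exists_rep q'
  refine ⟨Φ, Ψ, ?_, ?_, fun τ σ hΨ => hqq' ?_⟩
  · exact (SiegelCMPoint.not_exists_inducedCMType_iff_isPrimitive Φ φ₀).1
      (not_exists_inducedCMType_of_finrank_eq_eight hcyc h8 Φ)
  · exact (SiegelCMPoint.not_exists_inducedCMType_iff_isPrimitive Ψ φ₀).1
      (not_exists_inducedCMType_of_finrank_eq_eight hcyc h8 Ψ)
  · obtain ⟨γ, hγ⟩ := exists_cmTypeSmul_twist_eq_twist hcomm τ σ Φ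
    exact Quotient.sound ⟨γ, by rw [hΨ, hγ]⟩

/-! ### Cyclic CM fields of degree `10` and `12` (e.g. `ℚ(ζ₁₁)`, `ℚ(ζ₁₃)`) -/

/-- Cyclic CM field of degree `10`: `4` Galois classes. [cite: Shimura1998, §8.4 Example (1), p. 65]
[cite: DinaIonicaSijsling2022, §1.2 Def. 8] -/
theorem card_cmTypeGaloisClasses_eq_four_of_finrank_eq_ten [IsGalois ℚ K] (hcyc : IsCyclic (K ≃ₐ[ℚ] K))
    (h10 : finrank ℚ K = 10) : Nat.card (Quotient (cmTypeGaloisSetoid K)) = 4 := by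
  rw [cmTypeGaloisSetoid_eq_cmTypeEquivSetoid_of_isCyclic hcyc]
  exact card_classes_eq_four_of_isCyclic_of_finrank_eq_ten hcyc h10

/-- Cyclic CM field of degree `12` (Shimura's `ℚ(ζ₁₃)`): `6` Galois classes. [cite: Shimura1998, §8.4 Example (1), p. 65]
[cite: DinaIonicaSijsling2022, §1.2 Def. 8] -/
theorem card_cmTypeGaloisClasses_eq_six_of_finrank_eq_twelve [IsGalois ℚ K] (hcyc : IsCyclic (K ≃ₐ[ℚ] K))
    (h12 : finrank ℚ K = 12) : Nat.card (Quotient (cmTypeGaloisSetoid K)) = 6 := by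
  rw [cmTypeGaloisSetoid_eq_cmTypeEquivSetoid_of_isCyclic hcyc]
  exact card_classes_eq_six_of_isCyclic_of_finrank_eq_twelve hcyc h12

end Instances

/-! ### The prime cyclotomic fields `ℚ(ζ_p)` -/

section Cyclotomic

/-- **For `ℚ(ζ_p)` Galois equivalence of CM types is Shimura's «transformed onto each other by an automorphism of
`F`»** (`Gal(ℚ(ζ_p)/ℚ) ≅ (ℤ/p)ˣ` is cyclic). [cite: Shimura1998, §8.4 Example (1), p. 65] [cite: DinaIonicaSijsling2022, §1.2 Def. 8] -/
theorem cmTypeGaloisSetoid_eq_of_isCyclotomicExtension (p : ℕ) [Fact p.Prime] (L : Type) [Field L] [NumberField L]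
    [IsCMField L] [IsCyclotomicExtension {p} ℚ L] : cmTypeGaloisSetoid L = cmTypeEquivSetoid L := by
  haveI := IsCyclotomicExtension.isGalois {p} ℚ L
  exact cmTypeGaloisSetoid_eq_cmTypeEquivSetoid_of_isCyclic (isCyclic_algEquiv_of_isCyclotomicExtension_prime p L)

/-- … so `Φ ~_{Gal} Ψ ↔ IsAutTransform Φ Ψ` for `ℚ(ζ_p)`. [cite: Shimura1998, §8.4 Example (1), p. 65]
[cite: DinaIonicaSijsling2022, §1.2 Def. 8] -/
theorem cmTypeGaloisSetoid_r_iff_isAutTransform (p : ℕ) [Fact p.Prime] (L : Type) [Field L] [NumberField L]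
    [IsCMField L] [IsCyclotomicExtension {p} ℚ L] (Φ Ψ : CMType L) :
    (cmTypeGaloisSetoid L).r Φ Ψ ↔ Literature.AlgebraicGeometry.ComplexMultiplication.CyclotomicCMTypeResidueSets.IsAutTransform Φ Ψ := by
  rw [cmTypeGaloisSetoid_eq_of_isCyclotomicExtension p L, CyclotomicCMTypeClasses.rel_iff_isAutTransform]

/-- `(p − 1) · #{Galois classes of ℚ(ζ_p)} = Σ_{d ∣ p − 1, d odd} φ(d) 2^{(p−1)/2d}` (`p ≠ 2`).
[cite: Shimura1998, §8.4 Example (1), p. 65] [cite: DinaIonicaSijsling2022, §1.2 Def. 8] -/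
theorem sub_one_mul_card_cmTypeGaloisClasses_eq_sum (p : ℕ) [Fact p.Prime] (L : Type) [Field L] [NumberField L]
    [IsCMField L] [IsCyclotomicExtension {p} ℚ L] (hp2 : p ≠ 2) :
    (p - 1) * Nat.card (Quotient (cmTypeGaloisSetoid L)) =
      ∑ d ∈ (p - 1).divisors, if Even d then 0 else d.totient * 2 ^ ((p - 1) / 2 / d) := by
  rw [cmTypeGaloisSetoid_eq_of_isCyclotomicExtension p L]
  exact CyclotomicCMTypeClasses.sub_one_mul_card_classes_eq_sum p L hp2

end Cyclotomic

end Literature.NumberTheory.ComplexMultiplication
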